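import Summits.MatrixMultiplication.OmegaCensus.SmallFormats.MatMul22nRankFiniteFieldPlanes
import Summits.MatrixMultiplication.OmegaCensus.SmallFormats.RankOnePlaneCapQuant
import Literature.Computability.AlgebraicComplexity.Nazarov2023FiniteFieldRankBound
import HarnessLib

/-!
# ω-census family (a): `(q²+2)·R_𝔽_q(⟨2,2,n⟩) ≥ 3(q²+3)·n` over EVERY finite field (Alekseev–Nazarov), by cap counting

Cell `pub-omega` (unit `pub-omega-tensor-g6`), topic `Summits/MatrixMultiplication/OmegaCensus`
(sub-folder `SmallFormats`). Framing (verbatim): lottery ticket; floor = certified bounds/negative ranges.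
HONEST FRAMING: the VALUE `R_𝔽_q(⟨2,2,m⟩) ≥ 3(1 + 1/(q²+2))·m` is PRINTED — Alekseev–Nazarov 2019 (the case
`n = s = 2`, `f = K² + 3`, of Nazarov 2023's theorem, which the tree holds only as the NAMED FACT
`nazarov2023_rank_matMulTensor_ge`). New for the census is an UNCONDITIONAL kernel proof for every finite field by
a different route: aggregate cap counting over ALL dual-type planes and all rank-one row planes, with the incidence
numbers obtained from explicit injections (no `decide`; the `𝔽₂`/`𝔽₃` files `MatMul22nRankGF2LowerBound` /
`MatMul22nRankGF3ThirtySixElevenths` are the cases `q = 2` (`7n ≤ 2r`) and `q = 3` (`36n ≤ 11r`)). Nothing here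
is progress on `ω`.

THE ARGUMENT. Let `⟨2,2,n⟩ = ∑_{t<r} w_t ⊗ u_t ⊗ v_t` over `𝔽_q` and let `z / a / b` count the zero / rank-one /
invertible X-matrices `u_t`. Points of `P¹` are represented by `(1,c)` (`c ∈ 𝔽_q`) and `(0,1)`.
* (J) For `x, y ∈ P¹` and `μ ∈ 𝔽_q^×` the plane `span(x yᵀ, x ỹᵀ + μ x̃ yᵀ)` (`x̃, ỹ` the fixed complements) is
  sandwich-equivalent to the dual-number plane (explicit un-sandwiches), so by ENG2's module lemma
  (`JPlane.three_mul_add_card_le`) at most `r − 3n` of the `u_t` annihilate it. A zero `u` annihilates all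
  `(q+1)²(q−1)` of them, a rank-one `u` at least `q − 1` (`x, y` = its kernels, `μ` free), an invertible `u` at
  least `q + 1` (for every `x` exactly one `(y, μ)`). Summing: `(q+1)²(q−1)(3n + z) + (q−1)a + (q+1)b ≤ (q+1)²(q−1) r`.
* (L) lit's quantitative rank-one-plane cap (`card_vanishing_le_two_mul_sub`): each of the `q+1` planes `{λ zᵀ}`
  carries at most `2r − 6n` of the `u_t`; a zero `u` lies on all, a rank-one `u` on at least one. Summing:
  `(q+1)(6n + z) + a ≤ 2(q+1) r`.
* With `z + a + b = r`: `(q+1)[(q²+2) r − (3q²+9) n − q² z] = J-slack + 2·L-slack ≥ 0`, so **`(q²+2) r ≥ 3(q²+3) n`**.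
-/

namespace Summit.MatrixMultiplication.OmegaCensus.SmallFormats

open Module Matrix Literature.Computability.AlgebraicComplexity
open Summit.MatrixMultiplication.OmegaCensus.RankOnePlaneCapGeneral

/-! ### The counting theorem -/
section Count
variable {k : Type*} [Field k] [Fintype k] [DecidableEq k]

/-- **The counting over a finite field**: any decomposition of `⟨2,2,n⟩` over `𝔽_q` into `r` triads satisfies
`3(q²+3)·n ≤ (q²+2)·r`. -/
theorem three_mul_sq_add_three_mul_le_card (n r : ℕ) (w : Fin r → Fin 2 × Fin n → k)
    (u : Fin r → Fin 2 × Fin 2 → k) (v : Fin r → Fin 2 × Fin n → k)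
    (hdec : matMulTensor k 2 2 n = ∑ i, triad (w i) (u i) (v i)) :
    3 * (Fintype.card k ^ 2 + 3) * n ≤ (Fintype.card k ^ 2 + 2) * r := by
  classical
  set β := bilinCompOfTriads k w u v hdec with hβ
  have hA : ∀ i x, β.f i x = dotX (u i) x := fun i x => rfl
  -- (J) cap of each plane of the family, summed
  have hJ : ∀ p : JIdx k, 3 * n + (Finset.univ.filter fun i => dotX (u i) (famM p) = 0 ∧ dotX (u i) (famN p) = 0).card ≤ r := by
    intro p
    have h := (famPlane p).three_mul_add_card_le β u hA
      (fun i => dotX (u i) (famM p) = 0 ∧ dotX (u i) (famN p) = 0) (fun i hi => hi)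
    simpa only [Fintype.card_fin] using h
  have hJsum : ∑ p : JIdx k, (3 * n + (Finset.univ.filter fun i => dotX (u i) (famM p) = 0 ∧ dotX (u i) (famN p) = 0).card)
      ≤ ∑ _p : JIdx k, r := Finset.sum_le_sum fun p _ => hJ p
  rw [Finset.sum_add_distrib] at hJsum
  simp only [Finset.sum_const, Finset.card_univ, smul_eq_mul] at hJsum
  -- per-term incidence lower bounds, summed and swapped
  have hI : ∑ i, (Fintype.card (JIdx k) * (if u i = 0 then 1 else 0)
      + Fintype.card kˣ * (if (u i ≠ 0 ∧ u i (0, 0) * u i (1, 1) - u i (0, 1) * u i (1, 0) = 0) then 1 else 0)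
      + Fintype.card (Option k) * (if u i (0, 0) * u i (1, 1) - u i (0, 1) * u i (1, 0) ≠ 0 then 1 else 0))
      ≤ ∑ p : JIdx k, (Finset.univ.filter fun i => dotX (u i) (famM p) = 0 ∧ dotX (u i) (famN p) = 0).card := by
    calc _ ≤ ∑ i, (Finset.univ.filter fun p : JIdx k => dotX (u i) (famM p) = 0 ∧ dotX (u i) (famN p) = 0).card := by
          refine Finset.sum_le_sum fun i _ => ?_
          by_cases h0 : u i = 0
          · have hz : ∀ p : JIdx k, dotX (u i) (famM p) = 0 ∧ dotX (u i) (famN p) = 0 := by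
              intro p; simp [h0, dotX_eq]
            have e1 : (if u i = 0 then 1 else 0) = 1 := if_pos h0
            have e2 : (if (u i ≠ 0 ∧ u i (0, 0) * u i (1, 1) - u i (0, 1) * u i (1, 0) = 0) then 1 else 0) = 0 :=
              if_neg (fun h => h.1 h0)
            have e3 : (if u i (0, 0) * u i (1, 1) - u i (0, 1) * u i (1, 0) ≠ 0 then 1 else 0) = 0 :=
              if_neg (fun h => h (by rw [h0]; simp))
            rw [e1, e2, e3, mul_one, mul_zero, mul_zero, add_zero, add_zero,
              Finset.filter_true_of_mem fun p _ => hz p, Finset.card_univ]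
          · by_cases hd : u i (0, 0) * u i (1, 1) - u i (0, 1) * u i (1, 0) = 0
            · have := card_units_le_card_perp (u i) hd
              simp only [h0, hd, if_true, if_false, mul_one, mul_zero, add_zero, zero_add, ne_eq,
                not_false_eq_true, not_true_eq_false, true_and]
              exact this
            · have := card_option_le_card_perp (u i) hd
              simp only [h0, hd, if_true, if_false, mul_one, mul_zero, add_zero, zero_add, ne_eq,
                not_false_eq_true, and_false]
              exact this
      _ = _ := by
          simp only [Finset.card_filter]
          exact Finset.sum_comm
  -- (L) the quantitative cap of each of the q+1 row planes, summed
  have hRow : ∀ o : Option k, (Finset.univ.filter fun t => p1rep o ᵥ* xMat (u t) = 0).card + 6 * n ≤ 2 * r := by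
    intro o
    have h := card_vanishing_le_two_mul_sub (n := n) (le_refl 2) β (p1rep_ne_zero o)
      (Finset.univ.filter fun t => p1rep o ᵥ* xMat (u t) = 0)
      (fun i hi z => by
        rw [Finset.mem_filter] at hi
        rw [hA, dotX_vecMulVec_eq, hi.2, zero_dotProduct])
    simpa only [Fintype.card_fin] using h
  have hRsum : ∑ o : Option k, ((Finset.univ.filter fun t => p1rep o ᵥ* xMat (u t) = 0).card + 6 * n)
      ≤ ∑ _o : Option k, 2 * r := Finset.sum_le_sum fun o _ => hRow o
  rw [Finset.sum_add_distrib] at hRsum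
  simp only [Finset.sum_const, Finset.card_univ, smul_eq_mul] at hRsum
  have hL : ∑ i, (Fintype.card (Option k) * (if u i = 0 then 1 else 0)
      + (if (u i ≠ 0 ∧ u i (0, 0) * u i (1, 1) - u i (0, 1) * u i (1, 0) = 0) then 1 else 0))
      ≤ ∑ o : Option k, (Finset.univ.filter fun t => p1rep o ᵥ* xMat (u t) = 0).card := by
    calc _ ≤ ∑ i, (Finset.univ.filter fun o : Option k => p1rep o ᵥ* xMat (u i) = 0).card := by
          refine Finset.sum_le_sum fun i _ => ?_
          by_cases h0 : u i = 0
          · have hz : ∀ o : Option k, p1rep o ᵥ* xMat (u i) = 0 := by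
              intro o; ext j; simp [h0, xMat, Matrix.vecMul, dotProduct]
            have e1 : (if u i = 0 then 1 else 0) = 1 := if_pos h0
            have e2 : (if (u i ≠ 0 ∧ u i (0, 0) * u i (1, 1) - u i (0, 1) * u i (1, 0) = 0) then 1 else 0) = 0 :=
              if_neg (fun h => h.1 h0)
            rw [e1, e2, mul_one, add_zero, Finset.filter_true_of_mem fun o _ => hz o, Finset.card_univ]
          · by_cases hd : u i (0, 0) * u i (1, 1) - u i (0, 1) * u i (1, 0) = 0
            · simp only [h0, hd, if_false, mul_zero, zero_add, ne_eq, not_false_eq_true, true_and, if_true]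
              exact one_le_card_rowVan (u i) hd
            · simp [h0, hd]
      _ = _ := by
          simp only [Finset.card_filter]
          exact Finset.sum_comm
  -- bookkeeping
  set Z0 := Finset.univ.filter (fun t : Fin r => u t = 0) with hZ0
  set R1 := Finset.univ.filter (fun t : Fin r => u t ≠ 0 ∧ u t (0, 0) * u t (1, 1) - u t (0, 1) * u t (1, 0) = 0) with hR1
  set T2 := Finset.univ.filter (fun t : Fin r => u t (0, 0) * u t (1, 1) - u t (0, 1) * u t (1, 0) ≠ 0) with hT2
  have hpart : ∀ A : Fin 2 × Fin 2 → k, (if A = 0 then 1 else 0)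
      + (if (A ≠ 0 ∧ A (0, 0) * A (1, 1) - A (0, 1) * A (1, 0) = 0) then 1 else 0)
      + (if A (0, 0) * A (1, 1) - A (0, 1) * A (1, 0) ≠ 0 then 1 else 0) = 1 := by
    intro A
    by_cases h0 : A = 0
    · simp [h0]
    · by_cases hd : A (0, 0) * A (1, 1) - A (0, 1) * A (1, 0) = 0 <;> simp [h0, hd]
  have hpsum := Finset.sum_congr rfl fun i (_ : i ∈ (Finset.univ : Finset (Fin r))) => hpart (u i)
  rw [Finset.sum_add_distrib, Finset.sum_add_distrib, Finset.sum_boole, Finset.sum_boole, Finset.sum_boole] at hpsum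
  simp only [Finset.sum_const, Finset.card_univ, Fintype.card_fin, smul_eq_mul, mul_one, Nat.cast_id] at hpsum
  rw [Finset.sum_add_distrib, Finset.sum_add_distrib, ← Finset.mul_sum, ← Finset.mul_sum, ← Finset.mul_sum,
    Finset.sum_boole, Finset.sum_boole, Finset.sum_boole] at hI
  simp only [Nat.cast_id] at hI
  rw [Finset.sum_add_distrib, ← Finset.mul_sum, Finset.sum_boole, Finset.sum_boole] at hL
  simp only [Nat.cast_id] at hL
  rw [← hZ0, ← hR1, ← hT2] at hpsum hI
  rw [← hZ0, ← hR1] at hL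
  -- cardinalities of the index types
  have hq : Fintype.card k = Fintype.card kˣ + 1 := by
    rw [Fintype.card_units]; have := Fintype.card_pos (α := k); omega
  have hO : Fintype.card (Option k) = Fintype.card kˣ + 2 := by rw [Fintype.card_option, hq]
  have hF : Fintype.card (JIdx k) = (Fintype.card kˣ + 2) * ((Fintype.card kˣ + 2) * Fintype.card kˣ) := by
    rw [Fintype.card_prod, Fintype.card_prod, hO]
  rw [hF] at hI hJsum
  rw [hO] at hL hRsum
  rw [hq]
  -- the final linear combination (coefficients polynomial in q' = |kˣ|)
  set q' := Fintype.card kˣ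
  set z := Z0.card
  set a := R1.card
  set b := T2.card
  have key : (q' + 2) * (3 * ((q' + 1) ^ 2 + 3) * n) + (q' + 2) * ((q' + 1) ^ 2) * z
      ≤ (q' + 2) * (((q' + 1) ^ 2 + 2) * r) := by
    nlinarith [hI, hJsum, hL, hRsum, hpsum]
  have key2 : (q' + 2) * (3 * ((q' + 1) ^ 2 + 3) * n) ≤ (q' + 2) * (((q' + 1) ^ 2 + 2) * r) :=
    le_trans (Nat.le_add_right _ _) key
  exact Nat.le_of_mul_le_mul_left key2 (by omega)

/-- **`3(q²+3)·n ≤ (q²+2)·R_𝔽_q(⟨2,2,n⟩)`** for every finite field `𝔽_q` and every `n`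
(Alekseev–Nazarov 2019 / Nazarov 2023 at `n = s = 2`; here an unconditional kernel theorem by cap counting).
`q = 2`: `2R ≥ 7n`; `q = 3`: `11R ≥ 36n`; `q = 4`: `6R ≥ 19n`; `q = 5`: `9R ≥ 28n`. -/
theorem three_mul_sq_add_three_mul_le_tensorRank_matMulTensor_22n (k : Type*) [Field k] [Fintype k] (n : ℕ) :
    3 * (Fintype.card k ^ 2 + 3) * n ≤ (Fintype.card k ^ 2 + 2) * tensorRank (matMulTensor k 2 2 n) := by
  classical
  obtain ⟨w, u, v, hdec⟩ := exists_triad_decomposition_tensorRank (matMulTensor k 2 2 n)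
  exact three_mul_sq_add_three_mul_le_card n _ w u v hdec

/-- The `n = s = 2` case of Nazarov's theorem in its printed rational form, for EVERY finite field:
`(2+2−1)·(1 + 1/(f−1))·m ≤ R_F(⟨2,2,m⟩)` with `f(K,2,2) = K² + 3` — DISCHARGED (the named fact
`nazarov2023_rank_matMulTensor_ge` also covers the formats `s ≥ n ≥ 2` other than `n = s = 2`). -/
theorem nazarov2023_case_n2_s2 (F : Type) [Field F] [Fintype F] (m : ℕ) :
    ((2 + 2 - 1 : ℕ) : ℚ) * (1 + 1 / (nazarov2023F (Fintype.card F) 2 2 - 1)) * m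
      ≤ (tensorRank (matMulTensor F 2 2 m) : ℚ) := by
  have hf : nazarov2023F (Fintype.card F) 2 2 = (Fintype.card F : ℚ) ^ 2 + 3 := by
    simp [nazarov2023F]
  rw [hf]
  have h := three_mul_sq_add_three_mul_le_tensorRank_matMulTensor_22n F m
  have hq : (0 : ℚ) < (Fintype.card F : ℚ) ^ 2 + 2 := by positivity
  have h' : (3 : ℚ) * ((Fintype.card F : ℚ) ^ 2 + 3) * m ≤ ((Fintype.card F : ℚ) ^ 2 + 2) * (tensorRank (matMulTensor F 2 2 m) : ℚ) := by
    exact_mod_cast h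
  have e : ((2 + 2 - 1 : ℕ) : ℚ) * (1 + 1 / ((Fintype.card F : ℚ) ^ 2 + 3 - 1)) * m
      = (3 * ((Fintype.card F : ℚ) ^ 2 + 3) * m) / ((Fintype.card F : ℚ) ^ 2 + 2) := by
    have hne : (Fintype.card F : ℚ) ^ 2 + 3 - 1 ≠ 0 :=
      ne_of_gt (by have h := sq_nonneg (Fintype.card F : ℚ); linarith)
    field_simp
    ring
  rw [e, div_le_iff₀ hq]
  linarith

end Count

end Summit.MatrixMultiplication.OmegaCensus.SmallFormats
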